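import Summits.Ventures.QEC.Census.FoldTowerK
import HarnessLib

/-!
# Fold certificate of `[[288,12,18]]` — SEMANTICS of the kernel checks and the assembly lemmas

Cell `qec`, row type-11 (kernel C). What each kernel computation of the tower (`FoldTowerBase`, `FoldTowerL1c*`,
`FoldTowerZero*`, `FoldTowerLift*`, `FoldTowerL4c*`) MEANS, by the generic soundness theorems of `FoldDriver` /
`FoldLift` / `FoldAssembly` instantiated on the decided structural facts of `FoldTowerFacts`:

* predicates `K1 ⊇ N2 ∋ K2 ⊇ N3 ∋ K3`, `Q4` — the property the continuation `k_L` certifies for an enumerated word;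
* `hk1 … hk4`, `node1_sound`, `node4_sound` — a passing continuation / node gives the predicate;
* the assembly: `complete36_of … complete288_of` — from the (hypothesised) results of the computation files to
  «every word of `ker H^X(C288)` (= BB288, torus-flat convention) of weight `≤ 16` is a translate of a `T288`
  representative».  The computation results enter as HYPOTHESES (`runPlan node1Mod L = true`, …); the closing file
  `Theorems/BB288DistanceCertificateNoZLogicalBelowEighteen.lean` imports the computation files and discharges them.
No computation here.
-/

set_option exponentiation.threshold 512
set_option maxRecDepth 100000

namespace Summit.Ventures.QEC.Census.Fold.Tower

open Summit.Ventures.QEC.Census Summit.Ventures.QEC.Census.Fold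

/-! ## The predicates -/

/-- level-4 outputs: a translate of a `T288` class. -/
def Q4 (u : ℕ) : Prop := Matched 12 12 T288 u

/-- level-3 outputs: a translate of a `T144` class. -/
def K3 (u : ℕ) : Prop := Matched 12 6 T144 u

/-- what `node3` certifies for a 72-word: zero (mod `2^72`), the special class, or a good `G3`-fibre. -/
def N3 (u : ℕ) : Prop := u % 2 ^ 72 = 0 ∨ (popc 72 u = 6 ∧ Matched 6 6 [spec72] u) ∨ GoodFib G3 C144 16 K3 u

/-- level-2 outputs (72-words): side-match for weight `≤ 11`, and `N3`. -/
def K2 (u : ℕ) : Prop := (popc 72 u ≤ 11 → Matched 6 6 T72_10 u) ∧ N3 u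

/-- what `node2` certifies for a 36-word. -/
def N2 (v : ℕ) : Prop := v % 2 ^ 36 = 0 ∨ (popc 36 v = 4 ∧ Matched 6 3 [spec36a, spec36b] v) ∨ GoodFib G2 C72 16 K2 v

/-- level-1 outputs (36-words): side-match for weight `≤ 11`, and `N2`. -/
def K1 (v : ℕ) : Prop := (popc 36 v ≤ 11 → Matched 6 3 T36_10 v) ∧ N2 v

/-! ## Translation invariance of the predicates -/

/-- `transW_eq_zero_iff`: transW eq zero iff (auxiliary lemma of the fold-certificate soundness chain). -/
theorem transW_eq_zero_iff {l m : ℕ} (hl : 0 < l) (hm : 0 < m) (da db u : ℕ) :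
    transW l m da db u = 0 ↔ u % 2 ^ (2 * (l * m)) = 0 := by
  have hmod : transW l m da db u = transW l m da db (u % 2 ^ (2 * (l * m))) := by rw [transW, transW, lin_mod]
  constructor
  · intro h
    have := transW_inv hl hm (Nat.mod_lt u (Nat.two_pow_pos _)) da db
    rw [← hmod, h, transW, lin_zero] at this
    exact this.symm
  · intro h; rw [hmod, h, transW, lin_zero]

/-- `popc_transW'`: popc transW' (auxiliary lemma of the fold-certificate soundness chain). -/
theorem popc_transW' {l m : ℕ} (hl : 0 < l) (hm : 0 < m) (da db u : ℕ) :
    popc (2 * (l * m)) (transW l m da db u) = popc (2 * (l * m)) u := by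
  have hmod : transW l m da db u = transW l m da db (u % 2 ^ (2 * (l * m))) := by rw [transW, transW, lin_mod]
  rw [hmod, popc_transW hl hm, popc_mod]

/-- `hQ4`: hQ4 (auxiliary lemma of the fold-certificate soundness chain). -/
theorem hQ4 : ∀ da db u, Q4 (transW 12 12 da db u) → Q4 u :=
  fun _ _ _ h => matched_of_matched_transW (by decide) (by decide) h

/-- `hQ3`: hQ3 (auxiliary lemma of the fold-certificate soundness chain). -/
theorem hQ3 : ∀ da db u, K3 (transW 12 6 da db u) → K3 u :=
  fun _ _ _ h => matched_of_matched_transW (by decide) (by decide) h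

/-- a fibre over a word outside the window is empty. -/
theorem goodFib_of_ge {G : Geo} (hG : G.OK) {C : TCode} {W : ℕ} {Q : ℕ → Prop} {v : ℕ} (hv : 2 ^ G.ns ≤ v) :
    GoodFib G C W Q v := by
  intro u _ _ _ hfold
  exact absurd hfold (Nat.ne_of_lt (Nat.lt_of_lt_of_le (Geo.foldW_lt hG u) hv))

/-- `hN3`: hN3 (auxiliary lemma of the fold-certificate soundness chain). -/
theorem hN3 : ∀ da db u, N3 (transW 6 6 da db u) → N3 u := by
  intro da db u h
  rcases h with h0 | ⟨hp, hm⟩ | hg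
  · left
    rw [Nat.mod_eq_of_lt (by simpa using transW_lt (l := 6) (m := 6) (by decide) (by decide) da db u)] at h0
    exact (transW_eq_zero_iff (l := 6) (m := 6) (by decide) (by decide) da db u).1 h0
  · right; left
    exact ⟨by rwa [show (72 : ℕ) = 2 * (6 * 6) from rfl, popc_transW' (by decide) (by decide)] at hp,
      matched_of_matched_transW (by decide) (by decide) hm⟩
  · right; right
    exact goodFib_of_trans shape3 ok3 hC3 (ce3 da db) cb3 (hQ3 da db) hg

/-- `hQ2`: hQ2 (auxiliary lemma of the fold-certificate soundness chain). -/
theorem hQ2 : ∀ da db u, K2 (transW 6 6 da db u) → K2 u := by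
  intro da db u ⟨hs, hn⟩
  refine ⟨fun hp => matched_of_matched_transW (by decide) (by decide) (hs ?_), hN3 da db u hn⟩
  rwa [show (72 : ℕ) = 2 * (6 * 6) from rfl, popc_transW' (by decide) (by decide)]

/-- `hN2`: hN2 (auxiliary lemma of the fold-certificate soundness chain). -/
theorem hN2 : ∀ da db v, N2 (transW 6 3 da db v) → N2 v := by
  intro da db v h
  rcases h with h0 | ⟨hp, hm⟩ | hg
  · left
    rw [Nat.mod_eq_of_lt (by simpa using transW_lt (l := 6) (m := 3) (by decide) (by decide) da db v)] at h0
    exact (transW_eq_zero_iff (l := 6) (m := 3) (by decide) (by decide) da db v).1 h0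
  · right; left
    exact ⟨by rwa [show (36 : ℕ) = 2 * (6 * 3) from rfl, popc_transW' (by decide) (by decide)] at hp,
      matched_of_matched_transW (by decide) (by decide) hm⟩
  · right; right
    exact goodFib_of_trans shape2 ok2 hC2 (ce2 da db) cb2 (hQ2 da db) hg

/-- `hQ1`: hQ1 (auxiliary lemma of the fold-certificate soundness chain). -/
theorem hQ1 : ∀ da db v, K1 (transW 6 3 da db v) → K1 v := by
  intro da db v ⟨hs, hn⟩
  refine ⟨fun hp => matched_of_matched_transW (by decide) (by decide) (hs ?_), hN2 da db v hn⟩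
  rwa [show (36 : ℕ) = 2 * (6 * 3) from rfl, popc_transW' (by decide) (by decide)]

/-! ## Soundness of the continuations -/

/-- `hk4`: hk4 (auxiliary lemma of the fold-certificate soundness chain). -/
theorem hk4 : ∀ S', (∀ J ∈ S', J < G4.n) → S'.length = popc G4.n (maskOf S') → k4 S' = true → Q4 (maskOf S') :=
  fun _ hS _ h => matched_of_matchRep hS h

/-- `hk3`: hk3 (auxiliary lemma of the fold-certificate soundness chain). -/
theorem hk3 : ∀ S', (∀ J ∈ S', J < G3.n) → S'.length = popc G3.n (maskOf S') → k3 S' = true → K3 (maskOf S') :=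
  fun _ hS _ h => matched_of_matchRep hS h

/-- `node3_sound`: node3 sound (auxiliary lemma of the fold-certificate soundness chain). -/
theorem node3_sound {S : List ℕ} (hS : ∀ j ∈ S, j < 72) (hlen : S.length = popc 72 (maskOf S))
    (h : node3 S = true) : N3 (maskOf S) := by
  unfold node3 at h
  split at h
  · left; rfl
  · rw [Bool.or_eq_true, Bool.and_eq_true, beq_iff_eq] at h
    rcases h with ⟨hl, hm⟩ | h
    · right; left
      exact ⟨by rw [← hlen, hl], matched_of_matchRep hS hm⟩
    · right; right
      exact nodeCheckPT_sound shape3 ok3 hC3 ceg3 cb3 tf3 tp3 pall3 tr3 (hQ3 _ _) hk3 hS h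

/-- `hk2`: hk2 (auxiliary lemma of the fold-certificate soundness chain). -/
theorem hk2 : ∀ S', (∀ J ∈ S', J < G2.n) → S'.length = popc G2.n (maskOf S') → k2 S' = true → K2 (maskOf S') := by
  intro S' hS hlen h
  unfold k2 at h
  rw [Bool.and_eq_true, Bool.or_eq_true, decide_eq_true_eq] at h
  refine ⟨fun hp => ?_, node3_sound hS hlen h.2⟩
  rcases h.1 with hlt | hm
  · exfalso; change S'.length = popc 72 (maskOf S') at hlen; omega
  · exact matched_of_matchRep hS hm

/-- `node2_sound`: node2 sound (auxiliary lemma of the fold-certificate soundness chain). -/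
theorem node2_sound {S : List ℕ} (hS : ∀ j ∈ S, j < 36) (hlen : S.length = popc 36 (maskOf S))
    (h : node2 S = true) : N2 (maskOf S) := by
  unfold node2 at h
  split at h
  · left; rfl
  · rw [Bool.or_eq_true, Bool.and_eq_true, beq_iff_eq] at h
    rcases h with ⟨hl, hm⟩ | h
    · right; left
      exact ⟨by rw [← hlen, hl], matched_of_matchRep hS hm⟩
    · right; right
      exact nodeCheckPT_sound shape2 ok2 hC2 ceg2 cb2 tf2 tp2 pall2 tr2 (hQ2 _ _) hk2 hS h

/-- `hk1`: hk1 (auxiliary lemma of the fold-certificate soundness chain). -/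
theorem hk1 : ∀ S', (∀ J ∈ S', J < G1.n) → S'.length = popc G1.n (maskOf S') → k1 S' = true → K1 (maskOf S') := by
  intro S' hS hlen h
  unfold k1 at h
  rw [Bool.and_eq_true, Bool.or_eq_true, decide_eq_true_eq] at h
  refine ⟨fun hp => ?_, node2_sound hS hlen h.2⟩
  rcases h.1 with hlt | hm
  · exfalso; change S'.length = popc 36 (maskOf S') at hlen; omega
  · exact matched_of_matchRep hS hm

/-! ## Work plans -/

/-- `of_runPlan`: of runPlan (auxiliary lemma of the fold-certificate soundness chain). -/
theorem of_runPlan {F : ℕ → ℕ → ℕ → Bool} {L : List (ℕ × ℕ × ℕ)} (h : runPlan F L = true) {t q r : ℕ}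
    (hm : (t, q, r) ∈ L) : F t q r = true := by
  unfold runPlan at h; rw [List.all_eq_true] at h; exact h _ hm

/-- the expansion of a `(word, slices)` plan into work units. -/
def expand (PQ : List (ℕ × ℕ)) : List (ℕ × ℕ × ℕ) := PQ.flatMap fun p => (List.range p.2).map fun r => (p.1, p.2, r)

/-- `mem_expand`: mem expand (auxiliary lemma of the fold-certificate soundness chain). -/
theorem mem_expand {PQ : List (ℕ × ℕ)} {t q r : ℕ} (h : (t, q) ∈ PQ) (hr : r < q) : (t, q, r) ∈ expand PQ := by
  unfold expand; rw [List.mem_flatMap]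
  exact ⟨(t, q), h, List.mem_map.2 ⟨r, List.mem_range.2 hr, rfl⟩⟩

/-- `runPlan_append`: runPlan append (auxiliary lemma of the fold-certificate soundness chain). -/
theorem runPlan_append (F : ℕ → ℕ → ℕ → Bool) (A B : List (ℕ × ℕ × ℕ)) :
    runPlan F (A ++ B) = (runPlan F A && runPlan F B) := by
  unfold runPlan; rw [List.all_append]

/-- level 1: a covered nonzero `T18` word has a good fibre. -/
theorem node1_sound {L : List (ℕ × ℕ × ℕ)} (h : runPlan node1Mod L = true) {PQ : List (ℕ × ℕ)} (hL : expand PQ = L)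
    (hq : PQ.all (fun p => 0 < p.2) = true) {t q : ℕ} (hm : (t, q) ∈ PQ) (ht : t < 2 ^ 18) :
    GoodFib G1 C36 16 K1 t := by
  rw [List.all_eq_true] at hq
  have hq' : 0 < q := by simpa using hq _ hm
  have hnc : nodeCheckPT G1 (tab TF1 18) (tab TP1 18) (tab TR1 18) 16 31 false k1 (bitsOf 18 0 t) = true :=
    nodeCheckPT_of_nodeCheckModPT hq' fun res hres => by
      have := of_runPlan h (hL ▸ mem_expand hm hres); unfold node1Mod at this; exact this
  have hSb : ∀ j ∈ bitsOf 18 0 t, j < G1.ns := fun j hj => by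
    have := mem_bitsOf_bound 18 0 t j hj; change j < 18; omega
  have := nodeCheckPT_sound shape1 ok1 hC1 ceg1 cb1 tf1 tp1 pall1 tr1 (hQ1 _ _) hk1 hSb hnc
  rwa [maskOf_bitsOf_zero 18 t ht] at this

/-- level 4: a covered `T144` word has a good fibre. -/
theorem node4_sound {L : List (ℕ × ℕ × ℕ)} (h : runPlan node4Mod L = true) {PQ : List (ℕ × ℕ)} (hL : expand PQ = L)
    (hq : PQ.all (fun p => 0 < p.2) = true) {t q : ℕ} (hm : (t, q) ∈ PQ) (ht : t < 2 ^ 144) :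
    GoodFib G4 C288 16 Q4 t := by
  rw [List.all_eq_true] at hq
  have hq' : 0 < q := by simpa using hq _ hm
  have hnc : nodeCheckPT G4 (tab TF4 144) (tab TP4 144) (tab TR4 144) 16 509 false k4 (bitsOf 144 0 t) = true :=
    nodeCheckPT_of_nodeCheckModPT hq' fun res hres => by
      have := of_runPlan h (hL ▸ mem_expand hm hres); unfold node4Mod at this; exact this
  have hSb : ∀ j ∈ bitsOf 144 0 t, j < G4.ns := fun j hj => by
    have := mem_bitsOf_bound 144 0 t j hj; change j < 144; omega
  have := nodeCheckPT_sound shape4 ok4 hC4 ceg4 cb4 tf4 tp4 pall4 tr4 (hQ4 _ _) hk4 hSb hnc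
  rwa [maskOf_bitsOf_zero 144 t ht] at this

/-- parts of a zero check combine. -/
theorem zeroCheckS_append (G : Geo) (W : ℕ) (A B : List ℕ) (k : List ℕ → Bool) :
    zeroCheckS G W (A ++ B) k = (zeroCheckS G W A k && zeroCheckS G W B k) := by
  unfold zeroCheckS; rw [List.all_append]

/-! ## Assembly -/

/-- `mem_of_lt_two_pow`: mem of lt two pow (auxiliary lemma of the fold-certificate soundness chain). -/
theorem mem_of_lt_two_pow {T : List ℕ} {n : ℕ} (hT : T.all (fun t => t < 2 ^ n) = true) {t : ℕ} (ht : t ∈ T) : t < 2 ^ n := by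
  rw [List.all_eq_true] at hT; simpa using hT t ht

/-- **Level 1.** From the base (`complete18`), the zero node and the level-1 plan: every weight `≤ 16` word of
`ker H^X(C36)` satisfies `K1`. -/
theorem complete36_of
    (complete18 : ∀ u, u < 2 ^ 18 → C18.ker 18 u → popc 18 u ≤ 16 → Matched 3 3 T18 u)
    (hz : zeroCheckS G1 16 T18 k1 = true)
    {L : List (ℕ × ℕ × ℕ)} (h : runPlan node1Mod L = true) {PQ : List (ℕ × ℕ)} (hL : expand PQ = L)
    (hq : PQ.all (fun p => 0 < p.2) = true) (hcov : PQ.map (fun p => p.1) = T18.filter (fun t => !(t == 0)))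
    (hT : T18.all (fun t => t < 2 ^ 18) = true) :
    ∀ v, v < 2 ^ 36 → C36.ker 36 v → popc 36 v ≤ 16 → K1 v := by
  have hreps : ∀ t ∈ T18, GoodFib G1 C36 16 K1 t := by
    intro t ht
    by_cases h0 : t = 0
    · subst h0
      exact Geo.goodFib_zero_of_zeroCheck shape1 ok1 cf1 ceg1 ce1 hC1 cb1 (W := 16) (B := 8) (by decide)
        (Cands := T18) (fun c hc hk hw => complete18 c hc hk (by change popc 18 c ≤ 8 at hw; omega)) hQ1 hk1
          ((Geo.zeroCheckS_eq 16 T18 k1) ▸ hz)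
    · have hmem : t ∈ PQ.map (fun p => p.1) := by
        rw [hcov, List.mem_filter]; exact ⟨ht, by simpa using h0⟩
      obtain ⟨⟨t', q⟩, hpq, rfl⟩ := List.mem_map.1 hmem
      exact node1_sound h hL hq hpq (mem_of_lt_two_pow hT ht)
  exact complete_lift shape1 ok1 hC1 hCs1 cf1 ce1 cb1 hQ1 complete18 hreps

/-- **Level 2.** -/
theorem complete72_of (c36 : ∀ v, v < 2 ^ 36 → C36.ker 36 v → popc 36 v ≤ 16 → K1 v)
    (hz : zeroCheckS G2 16 T36_10 k2 = true) (hla : liftCheckS G2 16 STS2a T36_10 k2 = true)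
    (hlb : liftCheckS G2 16 STS2b T36_10 k2 = true) :
    ∀ u, u < 2 ^ 72 → C72.ker 72 u → popc 72 u ≤ 16 → K2 u := by
  have hCands : ∀ c, c < 2 ^ G2.ns → C36.ker G2.ns c → popc G2.ns c ≤ 11 → Matched G2.ls G2.ms T36_10 c :=
    fun c hc hk hw => (c36 c hc hk (by change popc 36 c ≤ 11 at hw; omega)).1 hw
  have hsta : GoodFib G2 C72 16 K2 spec36a :=
    Geo.goodFib_of_liftCheckS shape2 ok2 cf2 ceg2 hC2 cb2 (st := st2a) (B := 11) (by decide) (by unfold TCode.ker; decide +kernel)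
      (by decide +kernel) (by decide) (STS := STS2a) (by decide +kernel) hCands hQ2 hk2 hla
  have hstb : GoodFib G2 C72 16 K2 spec36b :=
    Geo.goodFib_of_liftCheckS shape2 ok2 cf2 ceg2 hC2 cb2 (st := st2b) (B := 11) (by decide) (by unfold TCode.ker; decide +kernel)
      (by decide +kernel) (by decide) (STS := STS2b) (by decide +kernel) hCands hQ2 hk2 hlb
  have hzero : GoodFib G2 C72 16 K2 0 :=
    Geo.goodFib_zero_of_zeroCheck shape2 ok2 cf2 ceg2 ce2 hC2 cb2 (W := 16) (B := 8) (by decide) (Cands := T36_10)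
      (fun c hc hk hw => hCands c hc hk (by change popc 36 c ≤ 8 at hw; change popc 36 c ≤ 11; omega)) hQ2 hk2
      ((Geo.zeroCheckS_eq 16 T36_10 k2) ▸ hz)
  refine complete_lift' ok2 cf2 fun s hs hk hw => ?_
  rcases (c36 s hs hk hw).2 with h0 | ⟨_, r, hr, da, db, htr⟩ | hg
  · change s < 2 ^ 36 at hs; rw [Nat.mod_eq_of_lt hs] at h0; subst h0; exact hzero
  · refine goodFib_of_trans shape2 ok2 hC2 (ce2 da db) cb2 (hQ2 da db) ?_
    change GoodFib G2 C72 16 K2 (transW 6 3 da db s); rw [htr]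
    simp only [List.mem_cons, List.not_mem_nil, or_false] at hr
    rcases hr with rfl | rfl
    · exact hsta
    · exact hstb
  · exact hg

/-- **Level 3.** -/
theorem complete144_of (c72 : ∀ u, u < 2 ^ 72 → C72.ker 72 u → popc 72 u ≤ 16 → K2 u)
    (hz : zeroCheckS G3 16 T72_10 k3 = true) (hl : liftCheckS G3 16 STS3 T72_10 k3 = true) :
    ∀ x, x < 2 ^ 144 → C144.ker 144 x → popc 144 x ≤ 16 → Matched 12 6 T144 x := by
  have hCands : ∀ c, c < 2 ^ G3.ns → C72.ker G3.ns c → popc G3.ns c ≤ 11 → Matched G3.ls G3.ms T72_10 c :=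
    fun c hc hk hw => (c72 c hc hk (by change popc 72 c ≤ 11 at hw; omega)).1 hw
  have hst : GoodFib G3 C144 16 K3 spec72 :=
    Geo.goodFib_of_liftCheckS shape3 ok3 cf3 ceg3 hC3 cb3 (st := st3) (B := 11) (by decide) (by unfold TCode.ker; decide +kernel)
      (by decide +kernel) (by decide) (STS := STS3) (by decide +kernel) hCands hQ3 hk3 hl
  have hzero : GoodFib G3 C144 16 K3 0 :=
    Geo.goodFib_zero_of_zeroCheck shape3 ok3 cf3 ceg3 ce3 hC3 cb3 (W := 16) (B := 8) (by decide) (Cands := T72_10)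
      (fun c hc hk hw => hCands c hc hk (by change popc 72 c ≤ 8 at hw; change popc 72 c ≤ 11; omega)) hQ3 hk3
      ((Geo.zeroCheckS_eq 16 T72_10 k3) ▸ hz)
  refine complete_lift' ok3 cf3 fun s hs hk hw => ?_
  rcases (c72 s hs hk hw).2 with h0 | ⟨_, r, hr, da, db, htr⟩ | hg
  · change s < 2 ^ 72 at hs; rw [Nat.mod_eq_of_lt hs] at h0; subst h0; exact hzero
  · refine goodFib_of_trans shape3 ok3 hC3 (ce3 da db) cb3 (hQ3 da db) ?_
    change GoodFib G3 C144 16 K3 (transW 6 6 da db s); rw [htr]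
    simp only [List.mem_cons, List.not_mem_nil, or_false] at hr
    subst hr; exact hst
  · exact hg

/-- **Level 4.** -/
theorem complete288_of (c144 : ∀ x, x < 2 ^ 144 → C144.ker 144 x → popc 144 x ≤ 16 → Matched 12 6 T144 x)
    (hz : zeroCheckS G4 16 T144 k4 = true) (hl : liftCheckS G4 16 STS4 (T144.filter fun c => popc 144 c ≤ 11) k4 = true)
    {L : List (ℕ × ℕ × ℕ)} (h : runPlan node4Mod L = true) {PQ : List (ℕ × ℕ)} (hL : expand PQ = L)
    (hq : PQ.all (fun p => 0 < p.2) = true)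
    (hcov : PQ.map (fun p => p.1) = T144.filter (fun t => !(t == 0) && !(t == spec144)))
    (hT : T144.all (fun t => t < 2 ^ 144) = true) :
    ∀ u, u < 2 ^ 288 → C288.ker 288 u → popc 288 u ≤ 16 → Matched 12 12 T288 u := by
  have hCands : ∀ c, c < 2 ^ G4.ns → C144.ker G4.ns c → popc G4.ns c ≤ 11 →
      Matched G4.ls G4.ms (T144.filter fun c => popc 144 c ≤ 11) c := by
    intro c hc hk hw
    obtain ⟨r, hr, da, db, htr⟩ := c144 c hc hk (by change popc 144 c ≤ 11 at hw; omega)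
    refine ⟨r, List.mem_filter.2 ⟨hr, ?_⟩, da, db, htr⟩
    rw [decide_eq_true_eq, ← htr, show (144 : ℕ) = 2 * (12 * 6) from rfl, popc_transW' (by decide) (by decide)]
    exact hw
  have hst : GoodFib G4 C288 16 Q4 spec144 :=
    Geo.goodFib_of_liftCheckS shape4 ok4 cf4 ceg4 hC4 cb4 (st := st4) (B := 11) (by decide) (by unfold TCode.ker; decide +kernel)
      (by decide +kernel) (by decide) (STS := STS4) (by decide +kernel) hCands hQ4 hk4 hl
  have hzero : GoodFib G4 C288 16 Q4 0 :=
    Geo.goodFib_zero_of_zeroCheck shape4 ok4 cf4 ceg4 ce4 hC4 cb4 (W := 16) (B := 8) (by decide) (Cands := T144)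
      (fun c hc hk hw => c144 c hc hk (by change popc 144 c ≤ 8 at hw; omega)) hQ4 hk4
      ((Geo.zeroCheckS_eq 16 T144 k4) ▸ hz)
  have hreps : ∀ t ∈ T144, GoodFib G4 C288 16 Q4 t := by
    intro t ht
    by_cases h0 : t = 0
    · subst h0; exact hzero
    by_cases h1 : t = spec144
    · subst h1; exact hst
    have hmem : t ∈ PQ.map (fun p => p.1) := by
      rw [hcov, List.mem_filter]; exact ⟨ht, by simp [h0, h1]⟩
    obtain ⟨⟨t', q⟩, hpq, rfl⟩ := List.mem_map.1 hmem
    exact node4_sound h hL hq hpq (mem_of_lt_two_pow hT ht)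
  exact complete_lift shape4 ok4 hC4 hCs4 cf4 ce4 cb4 hQ4 c144 hreps

end Summit.Ventures.QEC.Census.Fold.Tower
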